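import Summits.CriticalPhenomena.PercolationContinuityZ3.Theorems.PercNearOneGluingNoHeavyLowerTailSahiThreeCopyTwoPointCertsK5Table

/-!
# Sahi's three-function conjecture — `k = 5` certificate checks, entries 600–899

COMPUTATIONAL (`native_decide`, integer arithmetic): the flow-form / face-form certificates of `certTable5` (`…TwoPointCertsK5Table`,
data `…TwoPointCertsK5Data*`) pass `checkEntry5` for the entries 600 ≤ j < 900 (chunks of 60).  Seat `prim-sahi-p1`, generation 61;
`--supports stmt-CriticalPhenomena-4575`. [this work]
-/

namespace Summit.CriticalPhenomena.PercolationContinuityZ3.Theorems.SahiThreeCopy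

/-- ★★ The certificates of `certTable5` pass the exact check — entries 600–659 (by evaluation). [this work] -/
theorem checkChunk5_600 : checkChunk5 certTable5 upList5 (upSetsC 4) arrTab5 600 60 = true := by
  native_decide

/-- ★★ The certificates of `certTable5` pass the exact check — entries 660–719 (by evaluation). [this work] -/
theorem checkChunk5_660 : checkChunk5 certTable5 upList5 (upSetsC 4) arrTab5 660 60 = true := by
  native_decide

/-- ★★ The certificates of `certTable5` pass the exact check — entries 720–779 (by evaluation). [this work] -/
theorem checkChunk5_720 : checkChunk5 certTable5 upList5 (upSetsC 4) arrTab5 720 60 = true := by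
  native_decide

/-- ★★ The certificates of `certTable5` pass the exact check — entries 780–839 (by evaluation). [this work] -/
theorem checkChunk5_780 : checkChunk5 certTable5 upList5 (upSetsC 4) arrTab5 780 60 = true := by
  native_decide

/-- ★★ The certificates of `certTable5` pass the exact check — entries 840–899 (by evaluation). [this work] -/
theorem checkChunk5_840 : checkChunk5 certTable5 upList5 (upSetsC 4) arrTab5 840 60 = true := by
  native_decide


end Summit.CriticalPhenomena.PercolationContinuityZ3.Theorems.SahiThreeCopy
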